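import Summits.ValiantsHypothesis.ValiantsHypothesis.Theorems.MonotoneRestorationOrbitCompressionQPDiClosedOfInvariant
import Summits.ValiantsHypothesis.ValiantsHypothesis.Theorems.MonotoneRestorationOrbitCompressionQPDiZeta
import HarnessLib

/-!
# Route MonotoneRestoration — aside `OrbitCompressionQP` (stmt-ValiantsHypothesis-18332): the line
# `expression_compression` RE-CUT IN THE ONE-SORTED ALGEBRA — first stub PROVED, composition kernel-checked

The registered line cuts the aside at "narrow closed BIPARTITE expressions"; its first stub is false as
registered (p819407) and, repaired, still needs the open one-sorted → bipartite step (S1c).  In the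
ONE-SORTED algebra (`Literature.…DiPatternExpr`) the same cut has a PROVED first half:

* `di_orbitToNarrowExpression` — **Stub 1′ (THEOREM)**: square-symmetric circuits of quasi-polynomial
  ORBIT size for `f` ⇒ for one constant `c` and every `n ≥ 1`, `f n` is the closed polynomial of a
  one-sorted labelled pattern expression with `n^{k} ≤ 2^{(log₂ n + c)^c}` labels (any length) — verbatim
  the registered stub with `PatternExpr ℂ k l`, `n^{k+l}` replaced by `DiPatternExpr ℂ k`, `n^k`;
* `OrbitCompressionQP_of_diStubs` — **composition**: Stub 1′ (proved) and Stub 2′ = DI-COMPRESSION in the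
  same `∀ n ≥ 1` shape ("… ⇒ such expressions of LENGTH `≤ 2^{(log₂ n + c)^c}` too", the `VP`-load-bearing
  open half, taken as a hypothesis) give `OrbitCompressionQP`, through one-sorted ζ-P
  (`OrbitSupport.dizeta_symmetric_patternExpr_close`).

Suggested re-registration (planner): `Lines/di_expression_compression.lean` with exactly these two stubs;
Stub 1′ closes by name from `di_orbitToNarrowExpression`.  Helper file (`--supports
stmt-ValiantsHypothesis-18332`); def-free; nothing here is a named fact; the aside stays open.
-/

noncomputable section

open scoped Classical

-- `Summit.ValiantsHypothesis.ValiantsHypothesis.…` is the tree's single-conjunct layout (Sub = Summit).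
set_option linter.dupNamespace false

namespace Summit.ValiantsHypothesis.ValiantsHypothesis.Theorems

namespace OrbitSupport

open Literature.Computability.AlgebraicComplexity MvPolynomial DiPatternExpr

/-- **STUB 1′ — orbits to narrow ONE-SORTED expressions (THEOREM).** [cite: DawarPagoSeppelt2025, Theorem 1.1 and §7 (p. 45); DawarWilsenach2025, §6] -/
theorem di_orbitToNarrowExpression :
    ∀ f : (n : ℕ) → MvPolynomial (Fin n × Fin n) ℂ,
      (∃ c : ℕ, ∀ n : ℕ, ∃ (G : Type) (_ : Fintype G)
          (C : LabelledArithCircuit ℂ (Fin n × Fin n) Unit G),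
        C.IsSymmetric (Equiv.Perm (Fin n)) ∧ C.eval (C.output ()) = f n ∧
        C.orbitSize (Equiv.Perm (Fin n)) ≤ 2 ^ ((Nat.log 2 n + c) ^ c)) →
      ∃ c : ℕ, ∀ n : ℕ, 1 ≤ n → ∃ (k : ℕ) (e : DiPatternExpr ℂ k),
        n ^ k ≤ 2 ^ ((Nat.log 2 n + c) ^ c) ∧ e.close n = f n :=
  fun f horb => ((qpOrbitFamily_iff_diNarrow_one f).1 horb).2

/-- **COMPOSITION: Stub 1′ (proved) + Stub 2′ (DI-COMPRESSION, hypothesis) ⇒ `OrbitCompressionQP`**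
(one-sorted ζ-P for `n ≥ 1`, a one-gate constant circuit at `n = 0`). [folklore] -/
theorem OrbitCompressionQP_of_diStubs
    (stub2 : ∀ f : (n : ℕ) → MvPolynomial (Fin n × Fin n) ℂ,
      (∀ (n : ℕ) (σ τ : Equiv.Perm (Fin n)),
        MvPolynomial.rename (fun p : Fin n × Fin n => (σ p.1, τ p.2)) (f n) = f n) →
      IsVPFamily f →
      (∃ c : ℕ, ∀ n : ℕ, 1 ≤ n → ∃ (k : ℕ) (e : DiPatternExpr ℂ k),
        n ^ k ≤ 2 ^ ((Nat.log 2 n + c) ^ c) ∧ e.close n = f n) →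
      ∃ c : ℕ, ∀ n : ℕ, 1 ≤ n → ∃ (k : ℕ) (e : DiPatternExpr ℂ k),
        n ^ k ≤ 2 ^ ((Nat.log 2 n + c) ^ c) ∧ e.length ≤ 2 ^ ((Nat.log 2 n + c) ^ c) ∧
        e.close n = f n) :
    Theses.MonotoneRestoration.OrbitCompressionQP := by
  intro f hsymm hVP horb
  obtain ⟨c, hc⟩ := stub2 f hsymm hVP (di_orbitToNarrowExpression f horb)
  obtain ⟨c₃, hc₃⟩ := zeta_poly_mul_qp_le 12 2 c 2
  refine ⟨c₃, fun n => ?_⟩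
  rcases Nat.eq_zero_or_pos n with rfl | hn
  · obtain ⟨G, inst, C, hC, hev, hcard⟩ := zeta_symmetric_constant (X := Fin 0 × Fin 0)
      (Γ := Equiv.Perm (Fin 0)) (MvPolynomial.coeff 0 (f 0))
    refine ⟨G, inst, C, hC, ?_, hcard.trans Nat.one_le_two_pow⟩
    rw [hev]
    exact (MvPolynomial.eq_C_of_isEmpty (f 0)).symm
  · haveI : NeZero n := ⟨by omega⟩
    obtain ⟨k, e, hk, hlen, hclose⟩ := hc n hn
    obtain ⟨G, inst, C, hC, hev, hcard⟩ := dizeta_symmetric_patternExpr_close (n := n) e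
    exact ⟨G, inst, C, hC, by rw [hev, hclose], hcard.trans ((dizeta_qp_bound hk hlen).trans (hc₃ n))⟩

end OrbitSupport

end Summit.ValiantsHypothesis.ValiantsHypothesis.Theorems

end
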